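import Summits.HodgeConjecture.CorCM.HypLiu418.A3Liu418GSInstance
import Summits.HodgeConjecture.CorCM.HypLiu418.A3Liu418GSThmD6OneCurve
import Literature.NumberTheory.Automorphic.Liu2021.AppendixC.EtaleBettiComparison
import Literature.NumberTheory.Automorphic.Liu2021.AppendixC.BettiPinningHodgeSplit
import Literature.NumberTheory.Automorphic.UnitaryGroupLevelTransport
import Literature.NumberTheory.Automorphic.UnitaryGroupArchFactor
import Literature.NumberTheory.Automorphic.UnitaryGroupArchEmbedding
import Literature.AlgebraicGeometry.ShimuraVarieties.UnitaryBallQuotientDatum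
import Literature.NumberTheory.Automorphic.UnitaryCurveCohCotangentForms
import Literature.NumberTheory.Automorphic.UnitaryCurveConeFrameOfSig
import Summits.HodgeConjecture.HodgeConjecture.Theorems.F0AlbCmS1bSignedExclusionNec   -- ED. 6: the S1b exclusion on the NECESSITY letters E3nec₂ (F0P5-p02 (g4), T2′)
import Summits.HodgeConjecture.HodgeConjecture.Theorems.F0AlbCmS1bSignedExclusionNecPos   -- ED. 7: its twin on the ORIENTED letters #74R (PORT-4)
import Summits.HodgeConjecture.HodgeConjecture.Theorems.F0AlbCmS1RealisationHodge
import Literature.AlgebraicGeometry.HodgeTheory.HodgeTypeConjugateEmbeddingHolds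
import Literature.NumberTheory.Automorphic.UnitaryCurveCotangentSpectralProjectionConj
import Summits.HodgeConjecture.HodgeConjecture.Theorems.F0P5TP2Holds   -- ED. 4: TPhol ∕ T̄P are ★ kernel theorems (K-lane sub-line TP₂, letter ed. 3)
import Summits.HodgeConjecture.HodgeConjecture.Theorems.HLiu418E3Necessity   -- ED. 6: E3nec-antihol ⇐ E3nec-hol (conjugate partner, F0P5-p02 (g4), T1′)
import Summits.HodgeConjecture.HodgeConjecture.Theorems.HLiu418E3NecessityPos   -- ED. 7: the same derivation on the ORIENTED letters (PORT-2)
import Mathlib.RepresentationTheory.Intertwining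
import Mathlib.RepresentationTheory.Invariants
import HarnessLib

-- ED. 1 registrar pass (A-plan1 (g18), 2026-08-30T23:5xZ; director s355 cure): every `[cite: …]` tag inside a socket-`def`
-- docstring is rewritten as prose `(print: …)`; theorem tags kept; declarations byte-identical to F0P5-p04 (g0) rf v4 65cc60458a0977dd.
-- ED. 3 (F0P5-p04 (g2), 2026-08-31): `stub_S1_realisationHodge` CLOSED BY NAME over ★ p798983 `F0AlbCmS1RealisationHodge.stub_S1_realisationHodge_of_A1`
-- fed with the (A1) kernel ★ p799176 `ConjEmbedding.isOfHodgeType_conj_iff_holds` (F0P5-p02, K-A1) — NO named-fact hypothesis left on that stub;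
-- `stub_TPantihol` DERIVED from `stub_TPhol` (★ p797687, A-p06 (g18) BID 1); mathematical sorries 1 → 0; remaining `sorry`s = the named-fact stubs
-- E3hol ∕ E3antihol ∕ TPhol (declared floor-0 debt); every other declaration byte-identical to ED. 2 ff31971c3f600b60.
-- ED. 4 (F0P5-p03 (g2) cut for the registrar A-plan1 (g18), 2026-08-31T04:1xZ): `stub_TPhol` CLOSED BY NAME over ★ p808782 `F0P5TP2Holds.holCotFormSpectralProjection₂_holds`
-- (letter ed. 3 p807817 + TP₂ sub-line `Lines/F0_P5TP2SpectralProjection`, sorry-free); remaining `sorry`s = `stub_E3hol` ∕ `stub_E3antihol` (named facts).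
-- ED. 5 (F0P5-p03 (g2) cut): `stub_E3antihol` CLOSED BY NAME over ★ p811744 `E3AntiholOfHol.curveThetaHodgeTypeSigned_antihol_of_hol stub_E3hol` (p04 (g3) ROAD U); 1 `sorry` left = `stub_E3hol`.
-- ED. 6 (F0P5-p03 (g2) cut, desk word #11): E3 RE-LETTERED to the NECESSITY half «occurs ⇒ sign» (★ p813655 `Rogawski1990.curveThetaHodgeTypeNecessity_hol`; F0P5-p02 (g4) T1′∕T2′ `…Nec` twins); 1 `sorry` = `stub_E3hol`.

/-! ## FLOOR-0 SUB-SUB-LINE `Cruxes/HLiu418/Lines/F0_AlbCmS1bHodge` (module-to-be `…Cruxes.HLiu418.Lines.F0_AlbCmS1bHodge`) — the cut of the parent's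
registered stub `stub_S1b_hodge : S1bHodgeShape` (`Cruxes/HLiu418/Lines/F0_AlbCm.lean`, tree ed. 2 57fe71f0, :160–202) into TWO letters + a PROVED junction.
Crux item stmt-HodgeConjecture-24832 `HCCMUnconditional.HLiu418`; programme P5 (F0P5-plan (g0)); seat F0P5-p04 (g0) (the 🟧 sign seat); registrar A-plan2 (g16).
HONEST LABEL: HC_CM is proved only modulo the 7 printed citations until rung 0 closes; this file discharges none of them.

STRATEGY ([Liu2021] proof of Thm. D.6 (1), p. 140: «If `m_cusp(π^{(1,0)}_∞ ⊗ π^∞) = 1`, then `H¹_B(X,ℂ)[π^∞]` has Hodge type `(1,0)`», with Rem. D.5 deciding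
WHICH multiplicity is `1`).  The Hodge type of the `ω⋆_lab`-isotypic classes of the GS tower's own levels is read through a REALISATION of the pinned Betti
tower in the cone cotangent forms of ★ `UnitaryCurveCohCotangentForms` (M2, p793416) carrying a TYPE SPLIT (letter `S1RealisationHodgeShape` = F0P5-p01's
`S1RealisationShape` of the sibling sub-sub-line `F0_AlbCmS1Betti` PLUS the split clause; it implies `S1RealisationShape`), and the SIGNED EXCLUSION letter
`S1bSignedExclusionShape` ([Liu2021, Rem. D.5] ∘ [Lem. D.1 (4)] ∘ Hilbert reciprocity, arithmetic half ★ `Liu2021.RemD5.*`; automorphic half = F0P5-p02's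
★-pending `Rogawski1990.u2ThetaHodgeTypeSigned_hol∕_antihol` in the ♮ form): «`e♮ ∈ Φ_μ` ⇒ `ω⋆_lab` does not occur in the holomorphic cone forms at the place
of `ι₁`; `e♮ ∉ Φ_μ` ⇒ not in the antiholomorphic ones», `e♮ := (cmPlace F ι₁).1.embedding` (Mathlib's representative of the place; M2's cone and holomorphy
are built on it — NOT on `ι₁`: F0P5-p04 cert `CERT-E3signed-hol-VACUOUS` 686aab2e shows the `ι₁`-keyed form is contradictory).  ORIENTATION (sign table
`F0/P5/p04/SIGN-TABLE-RemD5.md` 536c8f6a, desk-accepted, ref1-countersigned): the GS level `A_K = Alb(X⋆_K)`, `X⋆_K = M_K ⊗_{F,c} F` (★ `sec42DataGS_X` `rfl`), so the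
fibre `A_K ⊗_{ι₁} ℂ` is `M_K ⊗_{ῑ₁} ℂ`: the CONJUGATE of M2's curve `M_K ⊗_{e♮} ℂ` when `e♮ = ι₁` (split REVERSED: `H^{1,0} ↦ conj hol`), M2's curve itself when
`e♮ = ῑ₁` (split STRAIGHT).  JUNCTION (kernel, this file): ★-pending `AppendixC.BettiPinningHodgeSplit` (F0P5-p04 rf 6a787a41: the `rhoB`-equivariant Hodge
projector of a pinned tower + the ISOTYPIC SPLIT LEMMA `BettiPinning.isOfHodgeType_of_mem_isotypic`) in each of the four sub-cases `e♮ = ι₁ ∕ ῑ₁` × `ι₁ ∈ ∕ ∉ Φ_μ`;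
the cone frame of record is F0P5-p01's ★ `UnitaryCurveForms.nonempty_coneFrame_of_sig` (p795025, imported).

STUBS (EDITION 2: `stub_S1b_signedExclusion` CLOSED BY NAME over ★ p796247 modulo four NAMED-FACT stubs `stub_E3hol ∕ stub_E3antihol ∕ stub_TPhol ∕ stub_TPantihol`): `stub_S1_realisationHodge : S1RealisationHodgeShape` (L–XL = S1-R's legs R0–R7 + the Hodge-type leg R2∕R7 with the (α)(β) bit; p01∕A-p01∕A-p14),
`stub_S1b_signedExclusion : S1bSignedExclusionShape` (M = p02's E3₂♮ letters ★ + the automorphic junction «non-zero equivariant `ψ` into hol forms ⇒ a discrete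
`P` with `IsHolCotangentAt₂`, `HasFinComponent ω⋆`» + ★ `cmType_galConj` + ★ `exists_isAdmissibleElement_neg_iff_bar` + `locF (r ε) = ε`).
EDITION 3: `stub_S1_realisationHodge` CLOSED BY NAME over ★ p798983 (typed closer: (α) A-level transport ★ p797708 + (T2′) ★ p798192 + glue ★ p795030)
at the (A1) kernel ★ p799176 `ConjEmbedding.isOfHodgeType_conj_iff_holds`; `stub_TPantihol` derived from `stub_TPhol` (★ p797687).  Mathematical stubs of this
sub-sub-line: 0 open; named-fact stubs: E3hol ∕ E3antihol ∕ TPhol.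
HEAD: `stub_S1b_hodge_holds : S1bHodgeShape` (the parent's `stub_S1b_hodge` BY NAME: `exact F0AlbCmS1bHodge.stub_S1b_hodge_holds`).
[cite: Liu2021, Rem. D.5 p. 131; Prop. D.4 (1) p. 130; Lem. D.1 (4); Lem. D.2 (3) p. 127; proof of Thm. D.6 (1) p. 140 (l. 5625–5631); §D.2 (D.1) p. 128]
[cite: BorelWallach2000, VII 3.2] [cite: VoisinHodgeI2002, §6.1.3 Cor. 6.14, §7.3.2] -/

set_option autoImplicit false
set_option linter.dupNamespace false  -- `Summit.HodgeConjecture.HodgeConjecture.…` BY DESIGN (D-0017)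

noncomputable section

universe u

namespace Summit.HodgeConjecture.HodgeConjecture.Cruxes.HLiu418.F0AlbCmS1bHodge

open scoped TensorProduct Matrix NumberField Kronecker ComplexOrder
open NumberField NumberField.InfinitePlace IsDedekindDomain
open Summit.HodgeConjecture.CorCM.Model Summit.HodgeConjecture.CorCM.Model.HComp Summit.HodgeConjecture.CorCM.HComp
open Literature.AlgebraicGeometry.Motives (CMType AbelianVariety)
open Literature.AlgebraicGeometry.ShimuraVarieties Literature.AlgebraicGeometry.ShimuraVarieties.UnitaryCanonicalModel
open Literature.NumberTheory.Automorphic Literature.NumberTheory.Automorphic.UnitaryGroup Literature.NumberTheory.Automorphic.UnitaryCurveForms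
open Literature.NumberTheory.Automorphic.IdeleClassGroup Literature.NumberTheory.Automorphic.Liu2021 Literature.NumberTheory.Automorphic.Liu2021.AppendixC
open Literature.NumberTheory.GaloisRepresentations Literature.RepresentationTheory.Liu2021 Literature.RepresentationTheory.HarrisKudlaSweet1996
open Literature.AlgebraicGeometry.Liu2021 (IsAdmissibleElement)
open Literature.NumberTheory.Weil1964 Literature.NumberTheory.GelbartRogawski1991 Literature.NumberTheory.GelbartRogawski1991.UnitaryDualPair Literature.NumberTheory.GelbartRogawski1991.UnitaryDualPair.WeilCoinv
open Literature.NumberTheory.GelbartRogawski1991.UnitaryDualPair.LocalSplitting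
open Literature.NumberTheory.Automorphic.Liu2021.Def411WeilCarriersDoubling
open Literature.NumberTheory.Automorphic.Liu2021.Def411WeilCarriers (TW JW JW_eq isSymm_TW isUnit_det_TW Rep Eps epsOf Chi rhoVAtLine)
open Summit.HodgeConjecture.CorCM (CMField)
open Summit.HodgeConjecture.CorCM.Lines.A3Liu418

/-! ### §1 The cone frame of record = ★ `UnitaryCurveForms.nonempty_coneFrame_of_sig` (F0P5-p01, p795025; imported) -/

/-! ### §2 The two letter SHAPES -/

/-- **LETTER `S1RealisationHodgeShape` — S1-R WITH THE HODGE TYPE SPLIT.**  F0P5-p01's `S1RealisationShape` (injective, `cohForms₂ 𝔣`-valued,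
`rhoB`∕`rightRep₂`-equivariant `r : H → (U(J⋆)(𝔸_{F⁺}) → ℂ)` for every Betti pinning and every cone frame) PLUS, inside the same `∃ r`, the TYPE SPLIT of the
GS tower's level classes, keyed on the one bit `e♮ := (cmPlace F ι₁).1.embedding = ι₁` (Mathlib's representative of the place of `ι₁`, on which M2's cone
`negCone (J⋆.map e♮)` and holomorphy are built): if `e♮ = ι₁` the level `A_K ⊗_{ι₁} ℂ = Alb(M_K ⊗_{ῑ₁} ℂ)` (★ `sec42DataGS_X`: `X⋆_K = M_K ⊗_{F,c} F`) is the
CONJUGATE of M2's curve, so classes of type `(1,0)` realise in the CONJUGATE-holomorphic forms and those of type `(0,1)` in the holomorphic ones (REVERSED);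
if `e♮ = ῑ₁` it IS M2's curve (STRAIGHT).  Print: [Liu2021] §D.2 (D.1) with the Hodge types of [BorelWallach2000, VII 2.10∕3.6] («`H¹ = H^{1,0} ⊕ H^{0,1}`,
holomorphic and antiholomorphic harmonic forms»), [VoisinHodgeI2002, Cor. 7.6]; the conjugation of the complex structure flips `(1,0) ↔ (0,1)`
([Shimura1998, §8.5]; ★ `IsCMTypeRealisation.exists_conjugate` for the CM quotients).  Why it might fail: only through the bit (a slip would show as the MIRROR
of the registered clause pair at the junction; sign table `F0/P5/p04/SIGN-TABLE-RemD5.md` §1–§3).  Size: = S1-R (L∕XL) + S (the type leg is ★ R2 Hodge theory).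
(print: Liu2021, §D.2 (D.1) p. 128 and l. 5357–5359; §4.2 l. 2074–2081; proof of Thm. D.6 (1) p. 140) (print: BorelWallach2000, VII 2.10, 3.2, 3.6)
(print: VoisinHodgeI2002, Cor. 7.6, §7.3.2) (print: Shimura1998, §8.5) -/
def S1RealisationHodgeShape : Prop :=
  ∀ (F : CMField) (ι₁ : F →+* ℂ) (Jstar : Matrix (Fin 2) (Fin 2) (F : Type))
    (K₀ : C5.OpenCompactSubgroup ↥(finAdelic ↥(maximalRealSubfield (F : Type)) (F : Type) (IsCMField.complexConj (F : Type)) 2 Jstar))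
    (S : RecordSystemGS (F : Type) Jstar ι₁ K₀) (hU7ₛ : S.HeckeTranslateDefinedOver)
    (h4 : 4 ≤ Module.finrank ℚ (F : Type)) (isoₛ : ℕ → Prop)
    (H : Type) [AddCommGroup H] [Module ℂ H] (rhoB : Representation ℂ (sec42DataGS S h4 isoₛ).G H)
    (B : (sec42DataGS S h4 isoₛ).BettiPinning (sec42HeckeTranslatesGS S hU7ₛ h4 isoₛ) ι₁ H rhoB)
    (𝔣 : ConeFrame (F : Type) Jstar (cmPlace (F : Type) ι₁)),
    ∃ r : H →ₗ[ℂ] ((adelicGroupData ↥(maximalRealSubfield (F : Type)) (F : Type) (IsCMField.complexConj (F : Type)) 2 Jstar).Adelic → ℂ),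
      Function.Injective r ∧
      (∀ x : H, r x ∈ cohForms₂ ↥(maximalRealSubfield (F : Type)) (F : Type) (IsCMField.complexConj (F : Type)) Jstar
          (IsCMField.complexConj_ne_one (F : Type)) (UnitaryGroup.complexConj_smul_infinitePlace (F : Type))
          (cmPlace (F : Type) ι₁) 𝔣) ∧
      (∀ (g : (sec42DataGS S h4 isoₛ).G) (x : H),
        r (rhoB g x) = rightRep₂ ↥(maximalRealSubfield (F : Type)) (F : Type) (IsCMField.complexConj (F : Type)) Jstar g (r x)) ∧
      letI : Algebra (F : Type) ℂ := algebraAlong (F : Type) ι₁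
      ∀ (K : C5.SmallLevel K₀) (y : (sec42DataGS S h4 isoₛ).bettiH1 ι₁ K),
        ((cmPlace (F : Type) ι₁).1.embedding = ι₁ →
          (Literature.AlgebraicGeometry.HodgeTheory.IsOfHodgeType ((sec42DataGS S h4 isoₛ).A K).dim
              (((sec42DataGS S h4 isoₛ).A K).baseChange ℂ).X 1 1 0 y → r (B.b K y) ∈ (holCotForms₂ ↥(maximalRealSubfield (F : Type)) (F : Type) (IsCMField.complexConj (F : Type)) Jstar
          (IsCMField.complexConj_ne_one (F : Type)) (UnitaryGroup.complexConj_smul_infinitePlace (F : Type))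
          (cmPlace (F : Type) ι₁) 𝔣).map (conjFun₂ ↥(maximalRealSubfield (F : Type)) (F : Type) (IsCMField.complexConj (F : Type)) Jstar)) ∧
          (Literature.AlgebraicGeometry.HodgeTheory.IsOfHodgeType ((sec42DataGS S h4 isoₛ).A K).dim
              (((sec42DataGS S h4 isoₛ).A K).baseChange ℂ).X 1 0 1 y → r (B.b K y) ∈ holCotForms₂ ↥(maximalRealSubfield (F : Type)) (F : Type) (IsCMField.complexConj (F : Type)) Jstar
          (IsCMField.complexConj_ne_one (F : Type)) (UnitaryGroup.complexConj_smul_infinitePlace (F : Type))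
          (cmPlace (F : Type) ι₁) 𝔣)) ∧
        ((cmPlace (F : Type) ι₁).1.embedding ≠ ι₁ →
          (Literature.AlgebraicGeometry.HodgeTheory.IsOfHodgeType ((sec42DataGS S h4 isoₛ).A K).dim
              (((sec42DataGS S h4 isoₛ).A K).baseChange ℂ).X 1 1 0 y → r (B.b K y) ∈ holCotForms₂ ↥(maximalRealSubfield (F : Type)) (F : Type) (IsCMField.complexConj (F : Type)) Jstar
          (IsCMField.complexConj_ne_one (F : Type)) (UnitaryGroup.complexConj_smul_infinitePlace (F : Type))
          (cmPlace (F : Type) ι₁) 𝔣) ∧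
          (Literature.AlgebraicGeometry.HodgeTheory.IsOfHodgeType ((sec42DataGS S h4 isoₛ).A K).dim
              (((sec42DataGS S h4 isoₛ).A K).baseChange ℂ).X 1 0 1 y → r (B.b K y) ∈ (holCotForms₂ ↥(maximalRealSubfield (F : Type)) (F : Type) (IsCMField.complexConj (F : Type)) Jstar
          (IsCMField.complexConj_ne_one (F : Type)) (UnitaryGroup.complexConj_smul_infinitePlace (F : Type))
          (cmPlace (F : Type) ι₁) 𝔣).map (conjFun₂ ↥(maximalRealSubfield (F : Type)) (F : Type) (IsCMField.complexConj (F : Type)) Jstar)))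

/-- **LETTER `S1bSignedExclusionShape` — [Liu2021, Rem. D.5] AT THE REGISTERED LABEL, in FORMS currency (the 🟧 bit of the parent, settled by the sign table).**
Binders = F0P5-p01's `S1MultOneFormsShape` v3 (the parent's `S1BettiShape` prefix without the tower but WITH the compact-case guard
`h4 : 4 ≤ [F:ℚ]` after `_hsig` (ref1-O1), plus a cone frame `𝔣`); `ω⋆_lab` VERBATIM.  With
`e♮ := (cmPlace F ι₁).1.embedding` (the complex embedding that DEFINES M2's cone and complex structure = print's `τ′₁` under WORLD C): if `e♮ ∈ Φ_μ` then NO non-zero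
`U(J⋆)(𝔸_{F⁺,f})`-equivariant `ψ : ω⋆_lab → (U(J⋆)(𝔸_{F⁺}) → ℂ)` takes all its values in the holomorphic cone forms `holCotForms₂ 𝔣`; if `e♮ ∉ Φ_μ` then none
takes all its values in the antiholomorphic ones `(holCotForms₂ 𝔣).map conjFun₂`.  READING: `ω⋆_lab` = print's `ω(μᶜ, ε_{−e}, χ)` (splitting at `galConj μ`; ★
p751221 (K4); ε-dictionary EXACT at `δ′ = (2δ_F)⁻¹`, `CorCM/D2Bridge/OmegaAtDeltaPrime` audit), `ε` `μᶜ`-admissible (★ `isAdmissibleElement_conj_neg_iff`); by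
[Liu2021, Prop. D.4 (1)] (normal form `τ′₁ ∈ Φ_label`) + [Rem. D.5] («`m_cusp(π^{(1,0)} ⊗ π^∞) = 1` iff the collection is generated by an `e` negative on all of
`Φ`; `(0,1)` iff negative off `τ′₁`, positive at `τ′₁`») + [Lem. D.1 (4)] (companion label `μχ̌` with the collection flipped on the anisotropic set `T`) + Hilbert
reciprocity `#T ≡ [F⁺:ℚ] − 1` (★ p751708) — arithmetic half ★ (`Liu2021.RemD5.normalForm_selectors_of_isAdmissible_neg`, `companion_selectors_of_signature`,
`not_isAdmissible_flip_of_isAdmissible`): `e♮ ∈ Φ_{μᶜ}` ⇒ `(1,0)` on M2's curve, `e♮ ∈ Φ_μ` ⇒ `(0,1)`; endoscopic `ω⋆` has EXACTLY ONE of the two types, so the other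
does not occur among the cusp forms = the cone forms of `U(J⋆)` ([Liu2021, (D.1)], Matsushima; `U(J⋆)` anisotropic).  Automorphic half = ★-pending
`Rogawski1990.u2ThetaHodgeTypeSigned_hol∕_antihol` (F0P5-p02, ♮ form) at `λ := galConj μ`.  Why it might fail: only through the orientation bit (WORLD C vs
De79-literal), shared with `stub_D6`∕`HypLiu418` (REF1 (g11) m02).  Size M printed.
(print: Liu2021, Rem. D.5 p. 131 (l. 5396–5405); Prop. D.4 (1) p. 130–131; Lem. D.1 (4) (l. 5235); Lem. D.2 (3) p. 127; §D.2 (D.1) p. 128; Def. 4.12 p. 47)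
(print: Rogawski1990, §11) -/
def S1bSignedExclusionShape : Prop :=
  ∀ (F : CMField) [IsGalois ℚ F] (ι₁ : F →+* ℂ)
    (μ : Literature.NumberTheory.Automorphic.IdeleClassGroup (F : Type) →ₜ* Circle)
    (hμ : IdeleClassGroup.IsConjugateSymplectic (F : Type) μ)
    (_hw : IdeleClassGroup.HasWeight (F : Type) μ 1)
    (Jstar : Matrix (Fin 2) (Fin 2) (F : Type)) (t : (F : Type)) (ht : t ≠ 0) (_hτt : 0 < (ι₁ t).re) (_hτt' : (ι₁ t).im = 0)
    (gstar : GL (Fin 2) (F : Type))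
    (dJ : Fin 2 → (F : Type)) (hdJ : ∀ i, IsCMField.complexConj (F : Type) (dJ i) = dJ i) (hdJ0 : ∀ i, dJ i ≠ 0)
    (hg : formCongr ((IsCMField.complexConj (F : Type) : (F : Type) ≃ₐ[↥(maximalRealSubfield (F : Type))] (F : Type)) :
        (F : Type) →+* (F : Type)) gstar (t • Jstar) = Matrix.diagonal dJ)
    (_hsig : (∃ Tstar : GL (Fin 2) ℂ,
        formCongr (starRingEnd ℂ) Tstar ((Matrix.diagonal dJ).map ι₁) = Matrix.diagonal ![(1 : ℂ), -1]) ∧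
      ∀ τ' : (F : Type) →+* ℂ, InfinitePlace.mk τ' ≠ InfinitePlace.mk ι₁ → ((Matrix.diagonal dJ).map τ').PosDef)
    (h4 : 4 ≤ Module.finrank ℚ (F : Type))
    (r : Rep ↥(maximalRealSubfield (F : Type)) (imagUnitSq F))
    (ε : Eps ↥(maximalRealSubfield (F : Type)) (imagUnitSq F))
    (_hadm : ∃ e : (F : Type), IsAdmissibleElement (F : Type) hμ.cmType.1 e ∧
      epsOf ↥(maximalRealSubfield (F : Type)) (imagUnitSq F) (F : Type) (2 * imagUnit (F : Type))⁻¹ (-e) = ε)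
    (χ : Chi ↥(maximalRealSubfield (F : Type)) (F : Type) (IsCMField.complexConj (F : Type)))
    (𝔣 : ConeFrame (F : Type) Jstar (cmPlace (F : Type) ι₁)),
    ((cmPlace (F : Type) ι₁).1.embedding ∈ hμ.cmType.1 →
      ∀ ψ : Representation.IntertwiningMap
        ((rhoVAtLine ↥(maximalRealSubfield (F : Type)) (F : Type) (IsCMField.complexConj (F : Type)) 2
          (finProdFinEquiv : Fin 2 × Fin 1 ≃ Fin (2 * 1)) (Matrix.diagonal dJ)
          (complexConj_imagUnit F) (imagUnit_ne_zero F) (imagUnit_mul_self F) (realDiagonal_isSymm F dJ hdJ)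
          (isUnit_det_realDiagonal F dJ hdJ hdJ0) (realDiagonal_map F dJ hdJ).symm
          (hsChiGS F finProdFinEquiv dJ hdJ hdJ0
            (toHeckeCharacter (F : Type) (galConj (IsCMField.complexConj (F : Type)) μ))
            (isUnitary_toHeckeCharacter (F : Type) (galConj (IsCMField.complexConj (F : Type)) μ))
            ((isOscillatorChar_toHeckeCharacter_iff (galConj (IsCMField.complexConj (F : Type)) μ)).mpr hμ.galConj))
          (r.toFun ε) χ).comp
          (finAdelicCongr ↥(maximalRealSubfield (F : Type)) (F : Type) (IsCMField.complexConj (F : Type)) gstar ht hg).symm.toMonoidHom)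
        (rightRep₂ ↥(maximalRealSubfield (F : Type)) (F : Type) (IsCMField.complexConj (F : Type)) Jstar),
        (∀ w, ψ w ∈ holCotForms₂ ↥(maximalRealSubfield (F : Type)) (F : Type) (IsCMField.complexConj (F : Type)) Jstar
          (IsCMField.complexConj_ne_one (F : Type)) (UnitaryGroup.complexConj_smul_infinitePlace (F : Type))
          (cmPlace (F : Type) ι₁) 𝔣) → ψ = 0) ∧
    ((cmPlace (F : Type) ι₁).1.embedding ∉ hμ.cmType.1 →
      ∀ ψ : Representation.IntertwiningMap
        ((rhoVAtLine ↥(maximalRealSubfield (F : Type)) (F : Type) (IsCMField.complexConj (F : Type)) 2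
          (finProdFinEquiv : Fin 2 × Fin 1 ≃ Fin (2 * 1)) (Matrix.diagonal dJ)
          (complexConj_imagUnit F) (imagUnit_ne_zero F) (imagUnit_mul_self F) (realDiagonal_isSymm F dJ hdJ)
          (isUnit_det_realDiagonal F dJ hdJ hdJ0) (realDiagonal_map F dJ hdJ).symm
          (hsChiGS F finProdFinEquiv dJ hdJ hdJ0
            (toHeckeCharacter (F : Type) (galConj (IsCMField.complexConj (F : Type)) μ))
            (isUnitary_toHeckeCharacter (F : Type) (galConj (IsCMField.complexConj (F : Type)) μ))
            ((isOscillatorChar_toHeckeCharacter_iff (galConj (IsCMField.complexConj (F : Type)) μ)).mpr hμ.galConj))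
          (r.toFun ε) χ).comp
          (finAdelicCongr ↥(maximalRealSubfield (F : Type)) (F : Type) (IsCMField.complexConj (F : Type)) gstar ht hg).symm.toMonoidHom)
        (rightRep₂ ↥(maximalRealSubfield (F : Type)) (F : Type) (IsCMField.complexConj (F : Type)) Jstar),
        (∀ w, ψ w ∈ (holCotForms₂ ↥(maximalRealSubfield (F : Type)) (F : Type) (IsCMField.complexConj (F : Type)) Jstar
          (IsCMField.complexConj_ne_one (F : Type)) (UnitaryGroup.complexConj_smul_infinitePlace (F : Type))
          (cmPlace (F : Type) ι₁) 𝔣).map (conjFun₂ ↥(maximalRealSubfield (F : Type)) (F : Type) (IsCMField.complexConj (F : Type)) Jstar)) → ψ = 0)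

/-! ### §3 The parent's letter `S1bHodgeShape`, PASTED TOKEN-IDENTICALLY from `Cruxes/HLiu418/Lines/F0_AlbCm.lean` (tree ed. 2 57fe71f0 :149–202) -/

/-- **`S1bHodgeShape`** — S1 clause (2) [Liu2021, Prop. D.4 (1) ∕ Rem. D.5 with Lem. D.2 (3)] in the BETTI ∕ HODGE currency of the tower's OWN
levels: for every Betti pinning `(H, rhoB, B)` of `sec42DataGS` along `ι₁`, every small level `K` and every level class `y ∈ H¹((A_K ×_{ι₁} ℂ)(ℂ); ℂ)`
whose image `b_K y ∈ H` lies in the `ω⋆`-ISOTYPIC part `⨆_ψ range ψ` (`ψ : ω⋆ → H` the `ℂ[G]`-maps), `y` is of Hodge type `(1,0)` if `ι₁ ∈ Φ_μ`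
(`hμ.cmType`) and of type `(0,1)` otherwise (tree ★ `HodgeTheory.IsOfHodgeType` on ★ `complexBetti ((A_K).baseChange ℂ).X 1` = `bettiH1Along (A_K) ι₁`
by `rfl`) — print: «if `m_cusp(π^{(1,0)}_∞ ⊗ π^∞) = 1` then `H¹_B(X, ℂ)[π^∞]` has Hodge type `(1,0)`» (proof of Thm. D.6 (1), p. 140) and Rem. D.5
(which of `m_cusp(π^{(1,0)}_∞ ⊗ ω)`, `m_cusp(π^{(0,1)}_∞ ⊗ ω)` is `1` is read off the sign of `ε` at `τ₁` against `Φ_μ`; the tree's `_hadm` fixes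
`ε = ε(−e)` with `e` `Φ_μ`-admissible).  The ARCHIMEDEAN ∕ automorphic content of `S1bShape` (Matsushima with Hodge types [BorelWallach2000, VII],
[Liu2021, Lem. D.2 (3)], [KonnoKonno2007, Thm. 5.4]); shared B4-archimedean desk (F0P2a).  🟧 carries the orientation (WORLD-C ∕ F-orient) bit of
the line: the clause pair is COPIED from `S1bShape` (same `ι₁ ∈ hμ.cmType.1` test, same `(1,0)`∕`(0,1)` assignment), so a convention slip shows
here and not in the transfer.  Why it might fail: only through that sign convention (both branches are asserted conditionally, as in `S1bShape`).
(print: Liu2021, Rem. D.5 p. 131; Lem. D.2 (3) p. 128; proof of Thm. D.6 (1) p. 140) (print: KonnoKonno2007, Thm. 5.4) -/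
def S1bHodgeShape : Prop :=
  ∀ (F : CMField) [IsGalois ℚ F] (ι₁ : F →+* ℂ)
    (μ : Literature.NumberTheory.Automorphic.IdeleClassGroup (F : Type) →ₜ* Circle)
    (hμ : IdeleClassGroup.IsConjugateSymplectic (F : Type) μ)
    (_hw : IdeleClassGroup.HasWeight (F : Type) μ 1)
    (Jstar : Matrix (Fin 2) (Fin 2) (F : Type)) (t : (F : Type)) (ht : t ≠ 0) (_hτt : 0 < (ι₁ t).re) (_hτt' : (ι₁ t).im = 0)
    (gstar : GL (Fin 2) (F : Type))
    (dJ : Fin 2 → (F : Type)) (hdJ : ∀ i, IsCMField.complexConj (F : Type) (dJ i) = dJ i) (hdJ0 : ∀ i, dJ i ≠ 0)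
    (hg : formCongr ((IsCMField.complexConj (F : Type) : (F : Type) ≃ₐ[↥(maximalRealSubfield (F : Type))] (F : Type)) :
        (F : Type) →+* (F : Type)) gstar (t • Jstar) = Matrix.diagonal dJ)
    (_hsig : (∃ Tstar : GL (Fin 2) ℂ,
        formCongr (starRingEnd ℂ) Tstar ((Matrix.diagonal dJ).map ι₁) = Matrix.diagonal ![(1 : ℂ), -1]) ∧
      ∀ τ' : (F : Type) →+* ℂ, InfinitePlace.mk τ' ≠ InfinitePlace.mk ι₁ → ((Matrix.diagonal dJ).map τ').PosDef)
    (K₀ : C5.OpenCompactSubgroup ↥(finAdelic ↥(maximalRealSubfield (F : Type)) (F : Type) (IsCMField.complexConj (F : Type)) 2 Jstar))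
    (S : RecordSystemGS (F : Type) Jstar ι₁ K₀) (hU7ₛ : S.HeckeTranslateDefinedOver)
    (h4 : 4 ≤ Module.finrank ℚ (F : Type)) (isoₛ : ℕ → Prop)
    (r : Rep ↥(maximalRealSubfield (F : Type)) (imagUnitSq F))
    (ε : Eps ↥(maximalRealSubfield (F : Type)) (imagUnitSq F))
    (_hadm : ∃ e : (F : Type), IsAdmissibleElement (F : Type) hμ.cmType.1 e ∧
      epsOf ↥(maximalRealSubfield (F : Type)) (imagUnitSq F) (F : Type) (2 * imagUnit (F : Type))⁻¹ (-e) = ε)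
    (χ : Chi ↥(maximalRealSubfield (F : Type)) (F : Type) (IsCMField.complexConj (F : Type)))
    (H : Type) [AddCommGroup H] [Module ℂ H] (rhoB : Representation ℂ (sec42DataGS S h4 isoₛ).G H)
    (B : (sec42DataGS S h4 isoₛ).BettiPinning (sec42HeckeTranslatesGS S hU7ₛ h4 isoₛ) ι₁ H rhoB)
    (K : C5.SmallLevel K₀) (y : (sec42DataGS S h4 isoₛ).bettiH1 ι₁ K),
    B.b K y ∈ ⨆ ψ : Representation.IntertwiningMap (G := (sec42DataGS S h4 isoₛ).G)
        ((rhoVAtLine ↥(maximalRealSubfield (F : Type)) (F : Type) (IsCMField.complexConj (F : Type)) 2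
          (finProdFinEquiv : Fin 2 × Fin 1 ≃ Fin (2 * 1)) (Matrix.diagonal dJ)
          (complexConj_imagUnit F) (imagUnit_ne_zero F) (imagUnit_mul_self F) (realDiagonal_isSymm F dJ hdJ)
          (isUnit_det_realDiagonal F dJ hdJ hdJ0) (realDiagonal_map F dJ hdJ).symm
          (hsChiGS F finProdFinEquiv dJ hdJ hdJ0
            (toHeckeCharacter (F : Type) (galConj (IsCMField.complexConj (F : Type)) μ))
            (isUnitary_toHeckeCharacter (F : Type) (galConj (IsCMField.complexConj (F : Type)) μ))
            ((isOscillatorChar_toHeckeCharacter_iff (galConj (IsCMField.complexConj (F : Type)) μ)).mpr hμ.galConj))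
          (r.toFun ε) χ).comp
          (finAdelicCongr ↥(maximalRealSubfield (F : Type)) (F : Type) (IsCMField.complexConj (F : Type)) gstar ht hg).symm.toMonoidHom)
        rhoB, LinearMap.range ψ.toLinearMap →
    letI : Algebra (F : Type) ℂ := algebraAlong (F : Type) ι₁
    (ι₁ ∈ hμ.cmType.1 →
      Literature.AlgebraicGeometry.HodgeTheory.IsOfHodgeType ((sec42DataGS S h4 isoₛ).A K).dim
        (((sec42DataGS S h4 isoₛ).A K).baseChange ℂ).X 1 1 0 y) ∧
    (ι₁ ∉ hμ.cmType.1 →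
      Literature.AlgebraicGeometry.HodgeTheory.IsOfHodgeType ((sec42DataGS S h4 isoₛ).A K).dim
        (((sec42DataGS S h4 isoₛ).A K).baseChange ℂ).X 1 0 1 y)

/-! ### §4 The two stubs of this sub-sub-line -/

/-- **`stub_S1_realisationHodge : S1RealisationHodgeShape` — CLOSED (ed. 3) BY NAME, no named-fact hypothesis** over ★ p798983
`F0AlbCmS1RealisationHodge.stub_S1_realisationHodge_of_A1` ((α) typed A-level record transport ★ p797708, conjugation at the A-level with types REVERSED;
(T2′) typed levelwise realisation `f_K = (Φ_K + conj ∘ Φ_K ∘ conj) ∘ tr_K` ★ p798192 (F0P5-p01); glue along the pinning with level identities ★ p795030),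
fed with the (A1) KERNEL ★ p799176 `ConjEmbedding.isOfHodgeType_conj_iff_holds` ([Deligne1979Valeurs, 0.2.5]: Hodge types along a conjugate pair of complex
embeddings are reversed; F0P5-p02, K-A1). [cite: Liu2021, §D.2 (D.1) p. 128] [cite: BorelWallach2000, VII 3.2, 3.6] [cite: Deligne1979Valeurs, 0.2.5 (p. 315)] -/
theorem stub_S1_realisationHodge : S1RealisationHodgeShape :=
  F0AlbCmS1RealisationHodge.stub_S1_realisationHodge_of_A1
    Literature.AlgebraicGeometry.HodgeTheory.ConjEmbedding.isOfHodgeType_conj_iff_holds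

/-- **STUB `stub_E3hol` — NAMED FACT (EDITION 7: RE-TYPED over the ORIENTED letter #74R ★ `curveThetaHodgeTypeNecessity_hol_pos`, p848618 — name kept, statement changed; #74 as typed was ruled MISSTATED, LEAD «LD-R1» 03:05:24Z) — declared debt, closes only by a `_holds` theorem (payer: the LD2 organ line), not a mathematical stub of this line** (s341; EDITION 6,
desk word #11: the NECESSITY HALF «a `(1,0)`-type occurrence of `ω(λ, ε_a, χ)_f` with `ε_a` λ-admissible forces `e♮ ∈ Φ_λ`», the only direction the chain consumes)
= ★ `Rogawski1990.curveThetaHodgeTypeNecessity_hol` (p813655, statement-only, F0P5-p02 (g4); weaker than ed. 5's `…Signed_hol`, ★ `…Necessity_hol_of_signed`). [cite: Liu2021, Rem. D.5 p. 131] [cite: Rogawski1990, §11] -/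
theorem stub_E3hol : Literature.NumberTheory.Rogawski1990.curveThetaHodgeTypeNecessity_hol_pos := by
  sorry

/-- **`stub_E3antihol` — DERIVED (ED. 5∕6), no longer a debt**: ★ `Rogawski1990.curveThetaHodgeTypeNecessity_antihol` from `stub_E3hol` by the
rank-2 conjugate partner, ★ `E3Necessity.curveThetaHodgeTypeNecessity_antihol_of_hol` (F0P5-p02 (g4) T1′, after p04 (g3)'s ROAD U ★ p811744). [cite: Liu2021, Rem. D.5 p. 131] [cite: Rogawski1990, §11] -/
theorem stub_E3antihol : Literature.NumberTheory.Rogawski1990.curveThetaHodgeTypeNecessity_antihol_pos :=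
  Summit.HodgeConjecture.HodgeConjecture.Cruxes.HLiu418.E3NecessityPos.curveThetaHodgeTypeNecessity_antihol_pos_of_hol_pos stub_E3hol

/-- **`stub_TPhol` — CLOSED BY NAME (ED. 4), no longer a debt**: ★ `UnitaryCurveForms.holCotFormSpectralProjection₂` (letter ed. 3 p807817, (D₂) hol
at hermitian `σ_ι H`: the spectral projection of a discrete `P` preserves holomorphic cotangent cone forms) IS the kernel theorem ★
`F0P5TP2Holds.holCotFormSpectralProjection₂_holds` (p808782; K-lane sub-line `Lines/F0_P5TP2SpectralProjection`: reproducing kernel on the cone, `L²`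
orbit regularity, Cauchy–Riemann on the slice). [cite: BorelWallach2000, VII 3.2] [cite: BorelJacquet1979, §4.6] -/
theorem stub_TPhol : Literature.NumberTheory.Automorphic.UnitaryCurveForms.holCotFormSpectralProjection₂ :=
  Summit.HodgeConjecture.HodgeConjecture.Cruxes.HLiu418.F0P5TP2Holds.holCotFormSpectralProjection₂_holds

/-- **`stub_TPantihol` — DERIVED (ed. 3), no longer an independent debt**: ★ `UnitaryCurveForms.antiholCotFormSpectralProjection₂` (p794463,
(D₂) antihol) from `stub_TPhol` by complex conjugation on `L²`, ★ p797687 `UnitaryCurveForms.antiholCotFormSpectralProjection₂_of_hol` (A-p06 (g18) BID 1).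
[cite: BorelWallach2000, VII 3.2] [cite: BorelJacquet1979, §4.6] -/
theorem stub_TPantihol : Literature.NumberTheory.Automorphic.UnitaryCurveForms.antiholCotFormSpectralProjection₂ :=
  Literature.NumberTheory.Automorphic.UnitaryCurveForms.antiholCotFormSpectralProjection₂_of_hol stub_TPhol

/-- **`stub_S1b_signedExclusion : S1bSignedExclusionShape` — CLOSED BY NAME** over ★ `F0AlbCmS1bSignedExclusionNec.stub_S1b_signedExclusion_of_nec_letters`
(F0P5-p02 (g4) T2′, EDITION 6 — twin of ★ p796247 `F0AlbCmS1bSignedExclusion.…_of_letters` on the NECESSITY letters: E3nec₂♮ at `λ := galConj c μ` + ★ `cmType_galConj`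
+ ★ `exists_isAdmissibleElement_neg_iff_bar` + `locF (r ε) = ε` + J₂ ★ `HLiu418ScalarSpectralJunction` + ω⋆ irreducible-or-zero ∕ smooth ★), modulo `stub_E3hol`. [cite: Liu2021, Rem. D.5 p. 131; proof of Thm. D.6 (1) p. 140] -/
theorem stub_S1b_signedExclusion : S1bSignedExclusionShape :=
  F0AlbCmS1bSignedExclusionNecPos.stub_S1b_signedExclusion_of_nec_letters_pos stub_E3hol stub_E3antihol stub_TPhol stub_TPantihol

/-! ### §5 The junction (kernel-checked; no `sorry` below this line) -/

/-- `S1RealisationHodgeShape` implies F0P5-p01's `S1RealisationShape` clauses (projection; recorded so that ONE realisation serves both sub-sub-lines).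
[cite: Liu2021, §D.2 (D.1) p. 128] -/
theorem s1Realisation_of_hodge (hR : S1RealisationHodgeShape) :
  ∀ (F : CMField) (ι₁ : F →+* ℂ) (Jstar : Matrix (Fin 2) (Fin 2) (F : Type))
    (K₀ : C5.OpenCompactSubgroup ↥(finAdelic ↥(maximalRealSubfield (F : Type)) (F : Type) (IsCMField.complexConj (F : Type)) 2 Jstar))
    (S : RecordSystemGS (F : Type) Jstar ι₁ K₀) (hU7ₛ : S.HeckeTranslateDefinedOver)
    (h4 : 4 ≤ Module.finrank ℚ (F : Type)) (isoₛ : ℕ → Prop)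
    (H : Type) [AddCommGroup H] [Module ℂ H] (rhoB : Representation ℂ (sec42DataGS S h4 isoₛ).G H)
    (B : (sec42DataGS S h4 isoₛ).BettiPinning (sec42HeckeTranslatesGS S hU7ₛ h4 isoₛ) ι₁ H rhoB)
    (𝔣 : ConeFrame (F : Type) Jstar (cmPlace (F : Type) ι₁)),
    ∃ r : H →ₗ[ℂ] ((adelicGroupData ↥(maximalRealSubfield (F : Type)) (F : Type) (IsCMField.complexConj (F : Type)) 2 Jstar).Adelic → ℂ),
      Function.Injective r ∧
      (∀ x : H, r x ∈ cohForms₂ ↥(maximalRealSubfield (F : Type)) (F : Type) (IsCMField.complexConj (F : Type)) Jstar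
          (IsCMField.complexConj_ne_one (F : Type)) (UnitaryGroup.complexConj_smul_infinitePlace (F : Type))
          (cmPlace (F : Type) ι₁) 𝔣) ∧
      ∀ (g : (sec42DataGS S h4 isoₛ).G) (x : H),
        r (rhoB g x) = rightRep₂ ↥(maximalRealSubfield (F : Type)) (F : Type) (IsCMField.complexConj (F : Type)) Jstar g (r x) := by
  intro F ι₁ Jstar K₀ S hU7ₛ h4 isoₛ H _ _ rhoB B 𝔣
  obtain ⟨r, hinj, hmem, heqv, -⟩ := hR F ι₁ Jstar K₀ S hU7ₛ h4 isoₛ H rhoB B 𝔣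
  exact ⟨r, hinj, hmem, heqv⟩

set_option maxHeartbeats 400000 in  -- the `ω⋆_lab` term is elaborated four times (two letters × two clauses); measured > 200 k
/-- **JUNCTION (PROVED): `S1RealisationHodgeShape → S1bSignedExclusionShape → S1bHodgeShape`.**  Four sub-cases `e♮ = ι₁ ∕ e♮ = ῑ₁` (Mathlib
`embedding_mk_eq`) × `ι₁ ∈ ∕ ∉ Φ_μ` (a CM type holds exactly one of `ι₁, ῑ₁`), each closed by the ISOTYPIC SPLIT LEMMA ★ `BettiPinning.isOfHodgeType_of_mem_isotypic`
with `(Ωhol, Ωanti)` := the pair (forms receiving the `(0,1)`-classes, forms receiving the `(1,0)`-classes) of that sub-case and the matching «no ψ» clause of the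
signed exclusion. [cite: Liu2021, proof of Thm. D.6 (1) p. 140 (l. 5625–5631); Rem. D.5 p. 131] -/
theorem s1bHodgeShape_of (hR : S1RealisationHodgeShape) (hX : S1bSignedExclusionShape) : S1bHodgeShape := by
  intro F _ ι₁ μ hμ hw Jstar t ht hτt hτt' gstar dJ hdJ hdJ0 hg hsig K₀ S hU7ₛ h4 isoₛ r ε hadm χ H _ _ rhoB B K y hy
  obtain ⟨𝔣⟩ := UnitaryCurveForms.nonempty_coneFrame_of_sig (F : Type) ι₁ Jstar t hτt hτt' gstar dJ hg hsig.1
  obtain ⟨rr, hinj, -, heqv, hsplit⟩ := hR F ι₁ Jstar K₀ S hU7ₛ h4 isoₛ H rhoB B 𝔣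
  obtain ⟨hXhol, hXanti⟩ := hX F ι₁ μ hμ hw Jstar t ht hτt hτt' gstar dJ hdJ hdJ0 hg hsig h4 r ε hadm χ 𝔣
  letI : Algebra (F : Type) ℂ := algebraAlong (F : Type) ι₁
  -- the place bit and the CM-type dichotomy
  have hbit : (cmPlace (F : Type) ι₁).1.embedding = ι₁ ∨
      (cmPlace (F : Type) ι₁).1.embedding = NumberField.ComplexEmbedding.conjugate ι₁ := embedding_mk_eq ι₁
  have hcm : ι₁ ∈ hμ.cmType.1 ↔ NumberField.ComplexEmbedding.conjugate ι₁ ∉ hμ.cmType.1 := hμ.cmType.2 ι₁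
  have hne : NumberField.ComplexEmbedding.conjugate ι₁ ≠ ι₁ := fun h =>
    (NumberField.InfinitePlace.isComplex_mk_iff.1 (isComplex_mk_of_isCMField (F : Type) ι₁))
      (NumberField.ComplexEmbedding.isReal_iff.2 h)
  -- «no ψ» in the plain-linear-map currency of the isotypic split lemma
  have noψ : ∀ (Ω : Submodule ℂ ((adelicGroupData ↥(maximalRealSubfield (F : Type)) (F : Type) (IsCMField.complexConj (F : Type)) 2 Jstar).Adelic → ℂ)),
      (∀ ψ : Representation.IntertwiningMap
        ((rhoVAtLine ↥(maximalRealSubfield (F : Type)) (F : Type) (IsCMField.complexConj (F : Type)) 2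
          (finProdFinEquiv : Fin 2 × Fin 1 ≃ Fin (2 * 1)) (Matrix.diagonal dJ)
          (complexConj_imagUnit F) (imagUnit_ne_zero F) (imagUnit_mul_self F) (realDiagonal_isSymm F dJ hdJ)
          (isUnit_det_realDiagonal F dJ hdJ hdJ0) (realDiagonal_map F dJ hdJ).symm
          (hsChiGS F finProdFinEquiv dJ hdJ hdJ0
            (toHeckeCharacter (F : Type) (galConj (IsCMField.complexConj (F : Type)) μ))
            (isUnitary_toHeckeCharacter (F : Type) (galConj (IsCMField.complexConj (F : Type)) μ))
            ((isOscillatorChar_toHeckeCharacter_iff (galConj (IsCMField.complexConj (F : Type)) μ)).mpr hμ.galConj))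
          (r.toFun ε) χ).comp
          (finAdelicCongr ↥(maximalRealSubfield (F : Type)) (F : Type) (IsCMField.complexConj (F : Type)) gstar ht hg).symm.toMonoidHom)
        (rightRep₂ ↥(maximalRealSubfield (F : Type)) (F : Type) (IsCMField.complexConj (F : Type)) Jstar),
        (∀ w, ψ w ∈ Ω) → ψ = 0) →
      ∀ ψ : _ →ₗ[ℂ] _, (∀ g w, ψ ((((rhoVAtLine ↥(maximalRealSubfield (F : Type)) (F : Type) (IsCMField.complexConj (F : Type)) 2
          (finProdFinEquiv : Fin 2 × Fin 1 ≃ Fin (2 * 1)) (Matrix.diagonal dJ)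
          (complexConj_imagUnit F) (imagUnit_ne_zero F) (imagUnit_mul_self F) (realDiagonal_isSymm F dJ hdJ)
          (isUnit_det_realDiagonal F dJ hdJ hdJ0) (realDiagonal_map F dJ hdJ).symm
          (hsChiGS F finProdFinEquiv dJ hdJ hdJ0
            (toHeckeCharacter (F : Type) (galConj (IsCMField.complexConj (F : Type)) μ))
            (isUnitary_toHeckeCharacter (F : Type) (galConj (IsCMField.complexConj (F : Type)) μ))
            ((isOscillatorChar_toHeckeCharacter_iff (galConj (IsCMField.complexConj (F : Type)) μ)).mpr hμ.galConj))
          (r.toFun ε) χ).comp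
          (finAdelicCongr ↥(maximalRealSubfield (F : Type)) (F : Type) (IsCMField.complexConj (F : Type)) gstar ht hg).symm.toMonoidHom)) g w) =
          (rightRep₂ ↥(maximalRealSubfield (F : Type)) (F : Type) (IsCMField.complexConj (F : Type)) Jstar) g (ψ w)) → (∀ w, ψ w ∈ Ω) → ψ = 0 := by
    intro Ω hno ψ hψG hψΩ
    have h := hno (ψ.intertwiningMap_of_isIntertwiningMap _ _ hψG) hψΩ
    have h0 : (ψ.intertwiningMap_of_isIntertwiningMap _ _ hψG).toLinearMap = ψ := rfl
    rw [← h0, h, Representation.IntertwiningMap.zero_toLinearMap]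
  -- the isotypic split lemma, both orientations
  have key := fun (Ωhol Ωanti : Submodule ℂ ((adelicGroupData ↥(maximalRealSubfield (F : Type)) (F : Type) (IsCMField.complexConj (F : Type)) 2 Jstar).Adelic → ℂ)) =>
    B.isOfHodgeType_of_mem_isotypic _ (rightRep₂ ↥(maximalRealSubfield (F : Type)) (F : Type) (IsCMField.complexConj (F : Type)) Jstar) Ωhol Ωanti rr hinj heqv K y hy
  rcases hbit with hb | hb
  · -- `e♮ = ι₁`: REVERSED split — `(1,0) ↦ conj hol =: Ωanti`, `(0,1) ↦ hol =: Ωhol`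
    have hs := fun (L : C5.SmallLevel K₀) (z : (sec42DataGS S h4 isoₛ).bettiH1 ι₁ L) => (hsplit L z).1 hb
    have k := key _ _ (fun L z => ⟨(hs L z).1, (hs L z).2⟩)
    refine ⟨fun hι => k.1 (noψ _ (hXhol (by rw [hb]; exact hι))), fun hι => k.2 (noψ _ (hXanti (by rw [hb]; exact hι)))⟩
  · -- `e♮ = ῑ₁`: STRAIGHT split — `(1,0) ↦ hol =: Ωanti`, `(0,1) ↦ conj hol =: Ωhol`
    have hb' : (cmPlace (F : Type) ι₁).1.embedding ≠ ι₁ := by rw [hb]; exact hne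
    have hs := fun (L : C5.SmallLevel K₀) (z : (sec42DataGS S h4 isoₛ).bettiH1 ι₁ L) => (hsplit L z).2 hb'
    have k := key _ _ (fun L z => ⟨(hs L z).1, (hs L z).2⟩)
    refine ⟨fun hι => k.1 (noψ _ (hXanti ?_)), fun hι => k.2 (noψ _ (hXhol ?_))⟩
    · rw [hb]; exact hcm.1 hι
    · rw [hb]; by_contra hc; exact hι (hcm.2 hc)

/-- **`stub_S1b_hodge_holds : S1bHodgeShape`** — the parent's `stub_S1b_hodge` by name; both mathematical stubs CLOSED BY NAME (ed. 2 ∕ ed. 3), so the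
the remaining `sorry` behind this head is the NAMED-FACT stub `stub_E3hol` only (declared floor-0 debt; ED. 4: `stub_TPhol` ★, ED. 5: `stub_E3antihol` ★ by name).
HC_CM is proved only modulo the 7 printed citations until rung 0 closes. [cite: Liu2021, Rem. D.5 p. 131; proof of Thm. D.6 (1) p. 140] -/
theorem stub_S1b_hodge_holds : S1bHodgeShape :=
  s1bHodgeShape_of stub_S1_realisationHodge stub_S1b_signedExclusion

end Summit.HodgeConjecture.HodgeConjecture.Cruxes.HLiu418.F0AlbCmS1bHodge

end
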